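import Mathlib
import Literature.Analysis.FluidPDE.VectorCalculus
import Summits.NavierStokesRegularity.NavierStokesRegularity.Theorems.UnthreadedDoorFluxStarvedDipoleSphereTangentUnthreaded
import Summits.NavierStokesRegularity.NavierStokesRegularity.Theorems.UnthreadedDoorFluxStarvedDipoleFluxStarvation
import Summits.NavierStokesRegularity.NavierStokesRegularity.Theorems.UnthreadedDoorFluxStarvedDipoleFluxStarvationWindow
import HarnessLib

/-!
# Route `UnthreadedDoor`, crux `PoloidalLiouville` (stmt-NavierStokesRegularity-1222), wall W1 — crux idea
# «flux-starved-dipoles»: NON-SOLID DIPOLAR SHELLS ARE AT REST (steady and window forms), UNCONDITIONAL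

The sketch composes `NonSolidDipolarShellAtRest` as `nonSolidDipolarShellAtRest_of : FluxStarvationSteady →
SphereTangentUnthreadedVanishes → NonSolidDipolarShellAtRest` and the window form as `nonSolidDipolarShellAtRestOn_of :
FluxStarvation → SphereTangentUnthreadedVanishes → NonSolidDipolarShellAtRestOn`.  All three inputs are now theorems
(`fluxStarvationSteady` p838510, `fluxStarvation` p838637, `sphereTangentUnthreadedVanishes` p839116); THIS FILE records the two
conclusions VERBATIM (sketch Props unfolded), by the sketch's own glue:

* `nonSolidDipolarShellAtRest` — an unthreaded incompressible `C¹` field which, as a drift, maintains a steady turning-axis dipole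
  potential that is non-solid on the shell `r₁ < ‖x−x₀‖ < r₂`, VANISHES on that shell;
* `nonSolidDipolarShellAtRestOn` — the same at each time of an open time set under the time-dependent law (E1).

HONEST LABEL: the dipole (`l = 1`) stratum of the LINEAR kinematic shadow of W1 (critic V28: information-grade, W1 movement 0); C2
`DipolarWindowIrrotational` (component argument) and K1′ (parabolic endgame) remain; `PoloidalLiouville` (1222), its wall
`stub_scalarLiouville` and the summit stay OPEN; NO Navier–Stokes regularity statement is proved.
`--supports stmt-NavierStokesRegularity-1222` (helper).  [folklore]
-/

noncomputable section

-- the summit and its single sub-problem share the name (CONVENTIONS §1)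
set_option linter.dupNamespace false

open Set Filter Topology InnerProductSpace
open scoped RealInnerProductSpace Laplacian
open Literature.Analysis.FluidPDE
open Summit.NavierStokesRegularity.NavierStokesRegularity.Theorems.PoloidalLiouville.HorizonTower (E3)

namespace Summit.NavierStokesRegularity.NavierStokesRegularity.Theorems.PoloidalLiouville.FluxStarvedDipole

/-- **NON-SOLID DIPOLAR SHELLS ARE AT REST, steady form** — the sketch Prop `FluxStarvedDipole.NonSolidDipolarShellAtRest` VERBATIM
(with `dipolePotential`, `IsNonSolidAt`, `SteadyKinematicLawOn` unfolded): an unthreaded incompressible `C¹` field `v` maintaining,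
as a drift, a steady dipole potential `T(x) = ⟪A(‖x−x₀‖), x−x₀⟫/‖x−x₀‖ + R(‖x−x₀‖)` (`A, R ∈ C³(0,∞)`) that is non-solid on the
shell `r₁ < ‖x−x₀‖ < r₂` vanishes on that shell (flux starvation gives tangency there, L0 gives the rest). [folklore] -/
theorem nonSolidDipolarShellAtRest :
    ∀ (v : E3 → E3) (x₀ : E3) (A : ℝ → E3) (R : ℝ → ℝ) (r₁ r₂ : ℝ), 0 ≤ r₁ → r₁ < r₂ →
      ContDiff ℝ 1 v → Literature.Analysis.FluidPDE.VectorCalculus.IsDivFree v →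
      ContDiffOn ℝ 3 A (Set.Ioi 0) → ContDiffOn ℝ 3 R (Set.Ioi 0) →
      (∀ x, r₁ < ‖x - x₀‖ → ‖x - x₀‖ < r₂ → ⟪x - x₀, curl v x⟫ = 0) →
      (∀ x ∈ ({x₀}ᶜ : Set E3),
        cross (gradient (fun z => ⟪v z, gradient (fun x => ⟪A ‖x - x₀‖, x - x₀⟫ / ‖x - x₀‖ + R ‖x - x₀‖) z⟫
            - Δ (fun x => ⟪A ‖x - x₀‖, x - x₀⟫ / ‖x - x₀‖ + R ‖x - x₀‖) z) x) (x - x₀)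
          = cross (gradient (fun z => ⟪v z, z - x₀⟫) x)
              (gradient (fun x => ⟪A ‖x - x₀‖, x - x₀⟫ / ‖x - x₀‖ + R ‖x - x₀‖) x)) →
      (∀ r, r₁ < r → r < r₂ → (A r ≠ 0 ∧ r * deriv (fun s => ‖A s‖) r ≠ ‖A r‖)) →
      ∀ x, r₁ < ‖x - x₀‖ → ‖x - x₀‖ < r₂ → v x = 0 := by
  intro v x₀ A R r₁ r₂ hr₁ hr₁₂ hv hdiv hA hR hunthr hlaw hns x hx₁ hx₂
  refine sphereTangentUnthreadedVanishes v x₀ r₁ r₂ hr₁ hr₁₂ hv hdiv ?_ hunthr x hx₁ hx₂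
  intro y hy₁ hy₂
  have hpos : 0 < ‖y - x₀‖ := lt_of_le_of_lt hr₁ hy₁
  exact fluxStarvationSteady v x₀ A R hv hdiv hA hR hlaw ‖y - x₀‖ hpos (hns ‖y - x₀‖ hy₁ hy₂) y rfl

/-- **NON-SOLID DIPOLAR SHELLS ARE AT REST ON A TIME WINDOW** — the sketch Prop `FluxStarvedDipole.NonSolidDipolarShellAtRestOn`
VERBATIM (with `dipolePotentialT`, `dipolePotential`, `IsNonSolidAt`, `KinematicLawOn` unfolded): at each time `t` of an open time
set `S`, an unthreaded incompressible flow maintaining (as a drift, law (E1)) a turning-axis dipole potential with jointly `C³` data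
vanishes on every shell of non-solid spheres. [folklore] -/
theorem nonSolidDipolarShellAtRestOn :
    ∀ (S : Set ℝ) (v : ℝ → E3 → E3) (x₀ : E3) (A : ℝ → ℝ → E3) (R : ℝ → ℝ → ℝ) (t r₁ r₂ : ℝ), IsOpen S → t ∈ S →
      0 ≤ r₁ → r₁ < r₂ →
      (∀ s ∈ S, ContDiff ℝ 1 (v s)) → (∀ s ∈ S, Literature.Analysis.FluidPDE.VectorCalculus.IsDivFree (v s)) →
      ContDiffOn ℝ 3 (Function.uncurry A) (S ×ˢ Set.Ioi 0) → ContDiffOn ℝ 3 (Function.uncurry R) (S ×ˢ Set.Ioi 0) →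
      (∀ x, r₁ < ‖x - x₀‖ → ‖x - x₀‖ < r₂ → ⟪x - x₀, curl (v t) x⟫ = 0) →
      (∀ s ∈ S, ∀ x, x ≠ x₀ →
        cross (gradient (fun z => deriv (fun s' => ⟪A s' ‖z - x₀‖, z - x₀⟫ / ‖z - x₀‖ + R s' ‖z - x₀‖) s
            + ⟪v s z, gradient (fun x => ⟪A s ‖x - x₀‖, x - x₀⟫ / ‖x - x₀‖ + R s ‖x - x₀‖) z⟫
            - Δ (fun x => ⟪A s ‖x - x₀‖, x - x₀⟫ / ‖x - x₀‖ + R s ‖x - x₀‖) z) x) (x - x₀)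
          = cross (gradient (fun z => ⟪v s z, z - x₀⟫) x)
              (gradient (fun x => ⟪A s ‖x - x₀‖, x - x₀⟫ / ‖x - x₀‖ + R s ‖x - x₀‖) x)) →
      (∀ r, r₁ < r → r < r₂ → (A t r ≠ 0 ∧ r * deriv (fun s => ‖A t s‖) r ≠ ‖A t r‖)) →
      ∀ x, r₁ < ‖x - x₀‖ → ‖x - x₀‖ < r₂ → v t x = 0 := by
  intro S v x₀ A R t r₁ r₂ hS ht hr₁ hr₁₂ hv hdiv hA hR hunthr hlaw hns x hx₁ hx₂
  refine sphereTangentUnthreadedVanishes (v t) x₀ r₁ r₂ hr₁ hr₁₂ (hv t ht) (hdiv t ht) ?_ hunthr x hx₁ hx₂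
  intro y hy₁ hy₂
  have hpos : 0 < ‖y - x₀‖ := lt_of_le_of_lt hr₁ hy₁
  exact fluxStarvation S v x₀ A R hS hv hdiv hA hR hlaw t ht ‖y - x₀‖ hpos (hns ‖y - x₀‖ hy₁ hy₂) y rfl

end Summit.NavierStokesRegularity.NavierStokesRegularity.Theorems.PoloidalLiouville.FluxStarvedDipole

end
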